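import Literature.MathematicalPhysics.QuantumFieldTheory.Balaban1983to89.B9Eq310HessianModePairingTwoBackgrounds

/-!
# `Balaban1983to89.B9Eq3120DeltaPiPrimeFormTwoBackgrounds` — T. Bałaban, *Propagators for lattice gauge theories in a background field*, Commun. Math. Phys.
# **99** (1985) 389–434 [Balaban1985BackgroundPropagators] (3.119)–(3.120) p. 419, p. 420, (3.36) p. 396, (3.69) p. 404, Thm 3.4 p. 400: **THE FORM DEFECT OF THE
# GAUGE-INVARIANT EXTENSION `π†Δ^ηπ − Δ^η` IS LIPSCHITZ IN THE BACKGROUND** — for two small backgrounds `U`, `V` (`‖U(b) − V(b)‖ ≤ δη`, `‖U(∂p) − V(∂p)‖ ≤ δη²`)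
# and `π_Xw = w − D_Xλ_X(w)`: `‖(⟨π_Uu, Δ^η(U)π_Uv⟩ − ⟨u, Δ^η(U)v⟩) − (⟨π_Vu, Δ^η(V)π_Vv⟩ − ⟨u, Δ^η(V)v⟩)‖ ≤ Θ̃·δ·N₁(u)N₁(v)` in the flat energy weight,
# modulo the DISPLAYED one- and two-background `λ`-letters — the two-background («(b3)») twin of the row OWNER's `B9Eq3120DeltaPiPrimeFormDiagonal`
# (storey (T3) of the two-background θ-letter of the `Δ_π` port; (T1) = `B9Eq34CurlGaugeModeTwoBackgrounds`, (T2) = `B9Eq325GaugeModeLetterTwoBackgrounds`)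

statement-level skeleton of published theorems with citation tags; proofs where landed; nothing here is a claim about the Yang–Mills mass gap

PDF held: `paper:balaban1985-cmp99-background-propagators` (journal page = PDF page + 388), pp. 391–392, 396, 400, 404, 419–420 — read by this lineage first-hand
(gens 73–78: p0003–p0004, p0008, p0012, p0016, p0031–p0032) and through the verbatim quotations of the suppliers named below.

CITATION HEADER (lean-in-tree rule 2026-08-18).  Audit cell `pub-balaban`, sub-cell `t4`, NE9 crux team (2): LEAF PROVER 04 (`b2b-balaban-t4-ne9-formalise-leaf-04`
gen 79), INTENT-1 = storey (T3) of OFFER O-ne9leaf04-g78-1 (the OWNER t4-ne9-p1's GO, journal `CLAIMS.log` l.53352 W-9 (α): «(T3)∕(T4) … for the successor =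
right»).  WHY (cell context; DIAGNOSIS D-ne9p1-g87-1, the OWNER's `Δ_π` port): the chain's `k`-th-step letters sit in print's `G₀`-slot; the port to
`G̃⁻¹ = Δ_π + DRD* + Q*aQ` ((3.122)) needs the θ-letter `|⟨u, (π†Δ^ηπ − Δ^η)v⟩| ≤ θ̄αN₁(u)N₁(v)` (ONE background: the OWNER's `…Diagonal` + NE9 leaf-02's
`…DiagonalClosed`).  NE9 compares TWO coupling histories, i.e. two small backgrounds: every storey of the energy ladder at the `π`-slot between `U` and `V`
((T4), the π twins of this lineage's gen-77∕78 `…TwoBackgrounds` files) consumes `‖⟨u, (π_U†Δ_Uπ_U − π_V†Δ_Vπ_V)v⟩‖ = O(δ)`.  Its bare part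
`⟨u, (Δ^η(U) − Δ^η(V))v⟩` is `B9Eq353FormDefectTowerTwoBackgrounds` (gen 77); THIS file is the remaining DEFECT part, abstract in the gauge-parameter maps
`λ_U`, `λ_V` so that it waits on no Green's-function letter (the closed corollary at `λ_X = G′_k(X)R_k(X)D*_X` is the sequel `…TwoBackgroundsClosed`).

THE PRINT.  p. 419 (verbatim, via the OWNER's host): *«(A, Δ_πA) = ⟨A − DG′RD*A, Δ(A − DG′RD*A)⟩ (3.119) … The quadratic form Δ′_π is a small perturbation
of Δ»*; p. 420: *«we will prove that this term is a small perturbation of Δ_a»*; p. 392 (verbatim via `B9Ineq369CurvatureSmall`): *«with our assumptions on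
the configuration U the operator Δ′ will be a bounded, small operator»*; p. 396 (3.35)–(3.36): the small-field windows (paraphrase); p. 400 Thm 3.4
(paraphrase): the propagators depend analytically on the background in the small-field region — read in the cell, as in every `…TwoBackgrounds` file, as
Lipschitz continuity between two points of the small-field ball, to FIRST order.

WHAT IS PROVED (sorry-free; proof lane — no `def`, no `Prop` placeholder; [folklore] scalar bookkeeping over `B9Eq310HessianModePairingTwoBackgrounds`).
* **`norm_form_defect_pi_sub_le`** — for `U(b), V(b) ∈ U1` with mutually adjoint transporters, `U`'s bond window `αη` (`V`'s is not needed: only `curl_U` of the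
  test fields is weighed), both plaquette windows `αη²`, closeness `δη` ∕ `δη²`,
  `0 ≤ α ≤ 1`, `0 ≤ δ`, `0 < η ≤ 1`, `|η|^d∕c₀ ≤ ρ_w`, the trace letter `‖τX‖ ≤ C_τ‖X‖`, ANY maps `λ_U, λ_V` from bond fields to site fields with
  `‖λ_X(w)‖ ≤ C_λN₁(w)`, `‖D_Xλ_X(w)‖ ≤ C_λ′N₁(w)` (`X = U, V`), `‖λ_U(w) − λ_V(w)‖ ≤ C_δδN₁(w)`, `‖D_Uλ_U(w) − D_Vλ_V(w)‖ ≤ C_δδN₁(w)`, and all `u, v`: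
  `‖(⟨u − D_Uλ_U(u), Δ^η(U)(v − D_Uλ_U(v))⟩ − ⟨u, Δ^η(U)v⟩) − (⟨u − D_Vλ_V(u), Δ^η(V)(v − D_Vλ_V(v))⟩ − ⟨u, Δ^η(V)v⟩)‖ ≤ Θ̃·δ·N₁(u)N₁(v)`,
  `Θ̃ = 2(Pb + P′) + (aC_λP + C_λ′P′) + ((sC_λ′ + P)aC_λ + κC_λ′C_δ)`, `P = a(5C_λ + C_δ)`, `P′ = saC_λ + κ′C_λ′ + κC_δ`, `a = 2M_φ′M_φ√#DirPair`,
  `s = 8√dM_φM_φ′`, `b = 1 + s`, `κ = 32dC_τM_φ²ρ_w`, `κ′ = 240dC_τM_φ²ρ_w` (the letters enter as reals WITH THEIR DEFINING EQUATIONS as hypotheses, and `N₁` as a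
  function with its defining equation `N₁(w) = √(‖curl₁w‖² + ‖div₁w‖² + ‖w‖²)` — a consumer instantiates them by `rfl`).  MECHANISM: `⟨π_Xu, Δ_Xπ_Xv⟩ − ⟨u, Δ_Xv⟩ =
  −⟨u, Δ_XK_Xv⟩ − ⟨K_Xu, Δ_Xv⟩ + ⟨K_Xu, Δ_XK_Xv⟩` (`K_X = D_Xλ_X`); differenced `U − V` the three terms are the supplier's §2 pairings
  (`⟨K_Uu, Δ_UK_Uv⟩ − ⟨K_Vu, Δ_VK_Vv⟩ = [mode pairing at x = K_Uu] + ⟨K_Uu − K_Vu, Δ_VK_Vv⟩`), fed with its §3 letters and leaf-02's holonomy-commutator letter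
  `‖curl_X(D_Xλ)‖ ≤ aα‖λ‖` — every term carries exactly one factor `δ`; `α ≤ 1` removes the rest.
MODEL ∕ DECLARED READINGS.  (M1) any torus `TSite d Pd`; fibre `W` read along `φ` (`M_φ`, `M_φ′`); weight `c₀`; scalar `η⁻¹`, `0 < η ≤ 1`; trace `τ`.  (M2) `hRS` ×2
(the unitary class), `U1` ×2, the four windows, the two closeness windows, `ρ_w`, and the SIX `λ`-letters are HYPOTHESES (their suppliers on the diagonal:
leaf-02's `B9Eq325GaugeModeLetterDiagonal` at `U` and at `V`, this lineage's (T2) `B9Eq325GaugeModeLetterTwoBackgrounds`).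
HONEST SCOPE.  [folklore] Cauchy–Schwarz bookkeeping over the cited letters; FIRST order between two small backgrounds; crude constants; the bare slot defect
`⟨u, (Δ^η(U) − Δ^η(V))v⟩` is NOT here (gen-77 `B9Eq353FormDefectTowerTwoBackgrounds`); no current `J`, no (3.117) as printed, no operator norm, no analyticity;
nothing of [B9] asserted beyond the suppliers.  NOT summit progress (cell pub-balaban: NE9 NOT PRINTED ∕ NOT PROVED; «NE9 ⇐ the named binders»; row WALLED ON A
MODEL (O-NE9-1; NEEDS-COORDINATOR #5 UNRULED); spine PROVED 0∕9; rung (B)+1 finite T⁴ — NOT infinite volume, NOT mass gap, NOT BetaPertH, NOT Clay).  HONEST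
DEPENDENCY (cell line): continuum YM on T⁴ ⇐ BetaPertH ∧ nine spine estimates (0/9 proved); BetaPertH ⇐ (D1) ∧ (D4) ∧ CAP+tail; G-an2-4 gates asym, D1 and
NE2/3/4.  NEW file; nothing modified.  Net new unproved facts: 0.
-/

noncomputable section

open scoped InnerProductSpace ComplexConjugate BigOperators

namespace Literature.MathematicalPhysics.QuantumFieldTheory.Balaban1983to89.B9Eq3120DeltaPiPrimeFormTwoBackgrounds

open B4Sect5Torus (TSite)
open B9SectCLatticeCarrier (Bond DirPair)
open B11Eq103H1Complex (SiteL2K BondL2K covDerivL2K covDivL2K)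
open B9Eq310HessianOperator (adTransportW hessOp covCurlL2K curvOp)
open B9Eq310DeltaPrime (plaqHolU)
open B7Prop1Explicit (U1)
open B9Eq34CurlGaugeModeWindow (norm_covCurlL2K_covDerivL2K_le_window)
open B9Eq310HessianModePairingTwoBackgrounds (norm_inner_hessOp_mode_sub_le norm_inner_mode_hessOp_sub_le norm_inner_hessOp_mode_le
  norm_covCurlL2K_sub_le_closeness norm_covCurlL2K_le_weight norm_inner_curvOp_le_window norm_inner_curvOp_sub_le_window norm_covCurl_covDeriv_sub_le_window₂)

variable {d : ℕ} {Pd : Fin d → ℕ}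
  {𝔸 : Type*} [NormedRing 𝔸] [NormedAlgebra ℂ 𝔸] [NormOneClass 𝔸] [StarRing 𝔸] [NormedStarGroup 𝔸] [StarModule ℂ 𝔸]
  {W : Type*} [NormedAddCommGroup W] [InnerProductSpace ℂ W] [FiniteDimensional ℂ W] (φ : W ≃ₗ[ℂ] 𝔸) {c₀ : ℝ} [Fact (0 < c₀)]
  {Mφ Mφ' : ℝ}

/-! ## §4 The assembly: the θ-defect of the `Δ_π` slot is Lipschitz in the background -/

set_option maxHeartbeats 400000 in
/-- **THE FORM DEFECT `π†Δ^ηπ − Δ^η` IS LIPSCHITZ IN THE BACKGROUND, IN THE FLAT ENERGY WEIGHT** — see the module header: for two unit-bounded backgrounds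
with mutually adjoint transporters, `U` in the bond window `αη`, both in the plaquette window `αη²`, `δη` ∕ `δη²`-close, `0 ≤ α ≤ 1`, `0 ≤ δ`, `0 < η ≤ 1`, `|η|^d∕c₀ ≤ ρ_w`, the trace
letter, ANY gauge-parameter maps `λ_U`, `λ_V` with the six displayed letters in the weight `N₁` (given with its defining equation), and the letters
`a, s, b, κ, κ′, P, P′` given with their defining equations:
`‖(⟨u − D_Uλ_U(u), Δ^η(U)(v − D_Uλ_U(v))⟩ − ⟨u, Δ^η(U)v⟩) − (⟨u − D_Vλ_V(u), Δ^η(V)(v − D_Vλ_V(v))⟩ − ⟨u, Δ^η(V)v⟩)‖ ≤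
(2(Pb + P′) + (aC_λP + C_λ′P′) + ((sC_λ′ + P)aC_λ + κC_λ′C_δ))·δ·N₁(u)N₁(v)`. [folklore]
[cite: Balaban1985BackgroundPropagators, (3.119)–(3.120) p.419, p.420, (3.36) p.396, (3.69) p.404, Thm 3.4 p.400] -/
theorem norm_form_defect_pi_sub_le (hMφ : 0 ≤ Mφ) (hMφ' : 0 ≤ Mφ') (hφ : ∀ w, ‖φ w‖ ≤ Mφ * ‖w‖) (hφ' : ∀ X, ‖φ.symm X‖ ≤ Mφ' * ‖X‖)
    (τ : 𝔸 →ₗ[ℂ] ℂ) {Cτ : ℝ} (hτ : ∀ X, ‖τ X‖ ≤ Cτ * ‖X‖) (hCτ : 0 ≤ Cτ) {ρw : ℝ}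
    {η : ℝ} (hη : 0 < η) (hη1 : η ≤ 1) (hρ : |η| ^ d / c₀ ≤ ρw) (U V : Bond d Pd → 𝔸ˣ)
    (hRSU : ∀ (b : Bond d Pd) (v u : W), ⟪adTransportW φ U b v, u⟫_ℂ = ⟪v, adTransportW φ (fun b => (U b)⁻¹) b u⟫_ℂ)
    (hRSV : ∀ (b : Bond d Pd) (v u : W), ⟪adTransportW φ V b v, u⟫_ℂ = ⟪v, adTransportW φ (fun b => (V b)⁻¹) b u⟫_ℂ)
    (hUb : ∀ b, U b ∈ U1 𝔸) (hVb : ∀ b, V b ∈ U1 𝔸) {α δ : ℝ} (hα0 : 0 ≤ α) (hα1 : α ≤ 1) (hδ0 : 0 ≤ δ)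
    (hUη : ∀ b, ‖(U b : 𝔸) - 1‖ ≤ α * η) (hUV : ∀ b, ‖(U b : 𝔸) - (V b : 𝔸)‖ ≤ δ * η)
    (hplU : ∀ p : B9SectCLatticeCarrier.Plaq d Pd, ‖(plaqHolU U p : 𝔸) - 1‖ ≤ α * η ^ 2)
    (hplV : ∀ p : B9SectCLatticeCarrier.Plaq d Pd, ‖(plaqHolU V p : 𝔸) - 1‖ ≤ α * η ^ 2)
    (hpp : ∀ p : B9SectCLatticeCarrier.Plaq d Pd, ‖(plaqHolU U p : 𝔸) - (plaqHolU V p : 𝔸)‖ ≤ δ * η ^ 2)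
    (N : BondL2K ℂ d Pd c₀ W → ℝ) (hN : ∀ z, N z = Real.sqrt (‖covCurlL2K ℂ c₀ ((η : ℂ))⁻¹ (adTransportW φ (fun _ : Bond d Pd => (1 : 𝔸ˣ))) z‖ ^ 2 +
      ‖covDivL2K ℂ c₀ ((η : ℂ))⁻¹ (adTransportW φ fun _ : Bond d Pd => (1 : 𝔸ˣ)⁻¹) z‖ ^ 2 + ‖z‖ ^ 2))
    (lamU lamV : BondL2K ℂ d Pd c₀ W → SiteL2K ℂ d Pd c₀ W) {Cl Cl' Cd : ℝ} (hCl : 0 ≤ Cl) (hCl' : 0 ≤ Cl') (hCd : 0 ≤ Cd)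
    (hlamU : ∀ w, ‖lamU w‖ ≤ Cl * N w) (hlamV : ∀ w, ‖lamV w‖ ≤ Cl * N w)
    (hDlamU : ∀ w, ‖covDerivL2K ℂ c₀ ((η : ℂ))⁻¹ (adTransportW φ U) (lamU w)‖ ≤ Cl' * N w)
    (hDlamV : ∀ w, ‖covDerivL2K ℂ c₀ ((η : ℂ))⁻¹ (adTransportW φ V) (lamV w)‖ ≤ Cl' * N w)
    (hlamUV : ∀ w, ‖lamU w - lamV w‖ ≤ Cd * δ * N w)
    (hDlamUV : ∀ w, ‖covDerivL2K ℂ c₀ ((η : ℂ))⁻¹ (adTransportW φ U) (lamU w) - covDerivL2K ℂ c₀ ((η : ℂ))⁻¹ (adTransportW φ V) (lamV w)‖ ≤ Cd * δ * N w)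
    {a s b κ κ' P P' : ℝ} (ha : a = 2 * (Mφ' * Mφ) * Real.sqrt (Fintype.card (DirPair d))) (hs : s = 8 * Real.sqrt d * (Mφ * Mφ'))
    (hb : b = 1 + s) (hκ : κ = 32 * d * Cτ * Mφ ^ 2 * ρw) (hκ' : κ' = 240 * d * Cτ * Mφ ^ 2 * ρw)
    (hP : P = a * (5 * Cl + Cd)) (hP' : P' = s * a * Cl + κ' * Cl' + κ * Cd)
    (u v : BondL2K ℂ d Pd c₀ W) :
    ‖(⟪u - covDerivL2K ℂ c₀ ((η : ℂ))⁻¹ (adTransportW φ U) (lamU u),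
          hessOp φ η U τ (v - covDerivL2K ℂ c₀ ((η : ℂ))⁻¹ (adTransportW φ U) (lamU v))⟫_ℂ - ⟪u, hessOp φ η U τ v⟫_ℂ) -
        (⟪u - covDerivL2K ℂ c₀ ((η : ℂ))⁻¹ (adTransportW φ V) (lamV u),
          hessOp φ η V τ (v - covDerivL2K ℂ c₀ ((η : ℂ))⁻¹ (adTransportW φ V) (lamV v))⟫_ℂ - ⟪u, hessOp φ η V τ v⟫_ℂ)‖ ≤
      (2 * (P * b + P') + (a * Cl * P + Cl' * P') + ((s * Cl' + P) * a * Cl + κ * Cl' * Cd)) * δ * N u * N v := by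
  -- §A nonnegativity of the letters
  have hc₀ : 0 < c₀ := Fact.out
  have ha0 : 0 ≤ a := by rw [ha]; positivity
  have hs0 : 0 ≤ s := by rw [hs]; positivity
  have hb0 : 0 ≤ b := by rw [hb]; exact add_nonneg zero_le_one hs0
  have hρw0 : 0 ≤ ρw := le_trans (by positivity) hρ
  have hκ0 : 0 ≤ κ := by rw [hκ]; exact mul_nonneg (by positivity) hρw0
  have hκ'0 : 0 ≤ κ' := by rw [hκ']; exact mul_nonneg (by positivity) hρw0
  have hP0 : 0 ≤ P := by rw [hP]; exact mul_nonneg ha0 (add_nonneg (mul_nonneg (by norm_num) hCl) hCd)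
  have hP'0 : 0 ≤ P' := by
    rw [hP']; exact add_nonneg (add_nonneg (mul_nonneg (mul_nonneg hs0 ha0) hCl) (mul_nonneg hκ'0 hCl')) (mul_nonneg hκ0 hCd)
  -- §B the weight
  have hN0 : ∀ z, 0 ≤ N z := fun z => by rw [hN]; exact Real.sqrt_nonneg _
  have hsq : ∀ {x S : ℝ}, 0 ≤ x → x ^ 2 ≤ S → x ≤ Real.sqrt S := fun hx h => by
    calc _ = Real.sqrt (_ ^ 2) := (Real.sqrt_sq hx).symm
      _ ≤ Real.sqrt _ := Real.sqrt_le_sqrt h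
  have hNn : ∀ z, ‖z‖ ≤ N z := fun z => by
    rw [hN]; exact hsq (norm_nonneg _) (le_add_of_nonneg_left (add_nonneg (sq_nonneg _) (sq_nonneg _)))
  have hNc : ∀ z, ‖covCurlL2K ℂ c₀ ((η : ℂ))⁻¹ (adTransportW φ (fun _ : Bond d Pd => (1 : 𝔸ˣ))) z‖ ≤ N z := fun z => by
    rw [hN]; exact hsq (norm_nonneg _) ((le_add_of_nonneg_right (sq_nonneg _)).trans (le_add_of_nonneg_right (sq_nonneg _)))
  -- §C the gauge modes `K_X w = D_X λ_X(w)` as opaque functions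
  obtain ⟨KU, hKU⟩ : ∃ f : BondL2K ℂ d Pd c₀ W → BondL2K ℂ d Pd c₀ W, ∀ w, f w = covDerivL2K ℂ c₀ ((η : ℂ))⁻¹ (adTransportW φ U) (lamU w) :=
    ⟨_, fun _ => rfl⟩
  obtain ⟨KV, hKV⟩ : ∃ f : BondL2K ℂ d Pd c₀ W → BondL2K ℂ d Pd c₀ W, ∀ w, f w = covDerivL2K ℂ c₀ ((η : ℂ))⁻¹ (adTransportW φ V) (lamV w) :=
    ⟨_, fun _ => rfl⟩
  simp only [← hKU, ← hKV]
  have hKUn : ∀ w, ‖KU w‖ ≤ Cl' * N w := fun w => by rw [hKU]; exact hDlamU w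
  have hKVn : ∀ w, ‖KV w‖ ≤ Cl' * N w := fun w => by rw [hKV]; exact hDlamV w
  have hKUV : ∀ w, ‖KU w - KV w‖ ≤ Cd * δ * N w := fun w => by rw [hKU, hKV]; exact hDlamUV w
  -- §D the letters of §3 at these windows
  have hcs := norm_covCurlL2K_sub_le_closeness φ hMφ hMφ' hφ hφ' hη hUb hVb hδ0 hUV (c₀ := c₀)
  have hcU := norm_covCurlL2K_le_weight φ hMφ hMφ' hφ hφ' hη hUb hα0 hα1 hUη N hNn hNc
  have hcvU := norm_inner_curvOp_le_window φ hMφ hφ hη hUb hα0 hτ hCτ hρ hplU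
  have hcvV := norm_inner_curvOp_le_window φ hMφ hφ hη hVb hα0 hτ hCτ hρ hplV
  have hcv' := norm_inner_curvOp_sub_le_window φ hMφ hφ hη hη1 hUb hVb hα0 hα1 hδ0 hτ hCτ hρ hUV hpp hplU
  have hcc := norm_covCurl_covDeriv_sub_le_window₂ φ hMφ hMφ' hφ hφ' hη hη1 hUb hVb hα0 hα1 hδ0 hUV hpp hplV (c₀ := c₀)
  rw [← hs] at hcs hcU
  rw [← hb] at hcU
  rw [← hκ] at hcvU hcvV
  rw [← hκ'] at hcv'
  rw [← ha] at hcc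
  -- the holonomy-commutator letters at `U` and at `V`: `‖curl_X(K_Xw)‖ ≤ aαC_λN(w) ≤ aC_λN(w)`
  have hcKU : ∀ w, ‖covCurlL2K ℂ c₀ ((η : ℂ))⁻¹ (adTransportW φ U) (KU w)‖ ≤ a * Cl * N w := fun w => by
    have h := norm_covCurlL2K_covDerivL2K_le_window φ hMφ hMφ' hφ hφ' hη.ne' hUb hα0 hplU (lamU w)
    rw [← ha, ← hKU] at h
    refine h.trans ?_
    calc a * α * ‖lamU w‖ ≤ a * 1 * (Cl * N w) := mul_le_mul (mul_le_mul_of_nonneg_left hα1 ha0) (hlamU w) (norm_nonneg _) (by positivity)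
      _ = a * Cl * N w := by ring
  have hcKV : ∀ w, ‖covCurlL2K ℂ c₀ ((η : ℂ))⁻¹ (adTransportW φ V) (KV w)‖ ≤ a * Cl * N w := fun w => by
    have h := norm_covCurlL2K_covDerivL2K_le_window φ hMφ hMφ' hφ hφ' hη.ne' hVb hα0 hplV (lamV w)
    rw [← ha, ← hKV] at h
    refine h.trans ?_
    calc a * α * ‖lamV w‖ ≤ a * 1 * (Cl * N w) := mul_le_mul (mul_le_mul_of_nonneg_left hα1 ha0) (hlamV w) (norm_nonneg _) (by positivity)
      _ = a * Cl * N w := by ring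
  -- the differenced holonomy commutator: `‖curl_U(K_Uw) − curl_V(K_Vw)‖ ≤ PδN(w)`
  have hcKUV : ∀ w, ‖covCurlL2K ℂ c₀ ((η : ℂ))⁻¹ (adTransportW φ U) (KU w) - covCurlL2K ℂ c₀ ((η : ℂ))⁻¹ (adTransportW φ V) (KV w)‖ ≤
      P * δ * N w := fun w => by
    have h := hcc (lamU w) (lamV w)
    rw [← hKU, ← hKV] at h
    refine h.trans ?_
    have e1 : 5 * δ * ‖lamU w‖ ≤ 5 * δ * (Cl * N w) := mul_le_mul_of_nonneg_left (hlamU w) (by positivity)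
    have e2 : α * ‖lamU w - lamV w‖ ≤ 1 * (Cd * δ * N w) := mul_le_mul hα1 (hlamUV w) (norm_nonneg _) zero_le_one
    rw [hP]
    nlinarith [mul_le_mul_of_nonneg_left (add_le_add e1 e2) ha0]
  -- curvature letters with `α ≤ 1` absorbed where a `δ` is already present
  have hcvU' : ∀ x y : BondL2K ℂ d Pd c₀ W, ‖⟪x, curvOp φ τ η U y⟫_ℂ‖ ≤ κ * ‖y‖ * ‖x‖ := fun x y =>
    (hcvU x y).trans (by nlinarith [mul_nonneg (norm_nonneg y) (norm_nonneg x), mul_le_mul_of_nonneg_left hα1 hκ0])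
  have hcvV' : ∀ x y : BondL2K ℂ d Pd c₀ W, ‖⟪x, curvOp φ τ η V y⟫_ℂ‖ ≤ κ * ‖y‖ * ‖x‖ := fun x y =>
    (hcvV x y).trans (by nlinarith [mul_nonneg (norm_nonneg y) (norm_nonneg x), mul_le_mul_of_nonneg_left hα1 hκ0])
  have hsδ : 0 ≤ s * δ := mul_nonneg hs0 hδ0
  have hκ'δ : 0 ≤ κ' * δ := mul_nonneg hκ'0 hδ0
  have hcs' : ∀ w : BondL2K ℂ d Pd c₀ W, ‖covCurlL2K ℂ c₀ ((η : ℂ))⁻¹ (adTransportW φ U) w - covCurlL2K ℂ c₀ ((η : ℂ))⁻¹ (adTransportW φ V) w‖ ≤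
      (s * δ) * ‖w‖ := fun w => (hcs w).trans_eq (by ring)
  have hcv'' : ∀ y x : BondL2K ℂ d Pd c₀ W, ‖⟪y, curvOp φ τ η U x - curvOp φ τ η V x⟫_ℂ‖ ≤ (κ' * δ) * ‖x‖ * ‖y‖ :=
    fun y x => (hcv' y x).trans_eq (by ring)
  -- §E the expansion
  have hexp : (⟪u - KU u, hessOp φ η U τ (v - KU v)⟫_ℂ - ⟪u, hessOp φ η U τ v⟫_ℂ) -
      (⟪u - KV u, hessOp φ η V τ (v - KV v)⟫_ℂ - ⟪u, hessOp φ η V τ v⟫_ℂ) =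
      -(⟪u, hessOp φ η U τ (KU v)⟫_ℂ - ⟪u, hessOp φ η V τ (KV v)⟫_ℂ) - (⟪KU u, hessOp φ η U τ v⟫_ℂ - ⟪KV u, hessOp φ η V τ v⟫_ℂ) +
        ((⟪KU u, hessOp φ η U τ (KU v)⟫_ℂ - ⟪KU u, hessOp φ η V τ (KV v)⟫_ℂ) + ⟪KU u - KV u, hessOp φ η V τ (KV v)⟫_ℂ) := by
    simp only [map_sub, inner_sub_left, inner_sub_right]; ring
  rw [hexp]
  -- §F the four pairings
  have TA := norm_inner_hessOp_mode_sub_le φ η U V τ hRSU hRSV hsδ hκ0 hκ'δ hcs' hcvV' hcv'' u (KU v) (KV v)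
    (hcKUV v) (hcKV v) (hKUn v) (hKUV v)
  have TB := norm_inner_mode_hessOp_sub_le φ η U V τ hRSU hRSV hκ0 hκ'δ hcs' hcvU' hcv'' v (KU u) (KV u)
    (hcKUV u) (hcKV u) (hKVn u) (hKUV u)
  have TC := norm_inner_hessOp_mode_sub_le φ η U V τ hRSU hRSV hsδ hκ0 hκ'δ hcs' hcvV' hcv'' (KU u) (KU v) (KV v)
    (hcKUV v) (hcKV v) (hKUn v) (hKUV v)
  have hcVx : ‖covCurlL2K ℂ c₀ ((η : ℂ))⁻¹ (adTransportW φ V) (KU u - KV u)‖ ≤ (s * Cl' + P) * δ * N u := by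
    have e : covCurlL2K ℂ c₀ ((η : ℂ))⁻¹ (adTransportW φ V) (KU u - KV u) =
        -(covCurlL2K ℂ c₀ ((η : ℂ))⁻¹ (adTransportW φ U) (KU u) - covCurlL2K ℂ c₀ ((η : ℂ))⁻¹ (adTransportW φ V) (KU u)) +
          (covCurlL2K ℂ c₀ ((η : ℂ))⁻¹ (adTransportW φ U) (KU u) - covCurlL2K ℂ c₀ ((η : ℂ))⁻¹ (adTransportW φ V) (KV u)) := by
      rw [map_sub]; abel
    rw [e]
    refine (norm_add_le _ _).trans ?_
    rw [norm_neg]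
    have t1 := (hcs (KU u)).trans (mul_le_mul_of_nonneg_left (hKUn u) (by positivity))
    have t2 := hcKUV u
    nlinarith [t1, t2]
  have TM := norm_inner_hessOp_mode_le φ η V τ hRSV hκ0 hcvV' (KU u - KV u) (KV v) (hcKV v) (hKVn v)
  -- §G scalar assembly
  have hNu := hN0 u; have hNv := hN0 v
  have hcUu := hcU u; have hcUv := hcU v
  have hnu := hNn u; have hnv := hNn v
  have hcKUu := hcKU u
  have hKUu := hKUn u
  have hKUVu := hKUV u
  have hNN : 0 ≤ N u * N v := mul_nonneg hNu hNv
  have hA : ‖⟪u, hessOp φ η U τ (KU v)⟫_ℂ - ⟪u, hessOp φ η V τ (KV v)⟫_ℂ‖ ≤ (P * b + P') * δ * N u * N v := by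
    refine TA.trans ?_
    have e1 : ‖covCurlL2K ℂ c₀ ((η : ℂ))⁻¹ (adTransportW φ U) u‖ * (P * δ * N v) ≤ (b * N u) * (P * δ * N v) :=
      mul_le_mul_of_nonneg_right hcUu (by positivity)
    have e2 : s * δ * ‖u‖ * (a * Cl * N v) ≤ s * δ * N u * (a * Cl * N v) :=
      mul_le_mul_of_nonneg_right (mul_le_mul_of_nonneg_left hnu hsδ) (by positivity)
    have e3 : κ' * δ * (Cl' * N v) * ‖u‖ ≤ κ' * δ * (Cl' * N v) * N u := mul_le_mul_of_nonneg_left hnu (by positivity)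
    have e4 : κ * (Cd * δ * N v) * ‖u‖ ≤ κ * (Cd * δ * N v) * N u := mul_le_mul_of_nonneg_left hnu (by positivity)
    have e5 : (P * b + P') * δ * N u * N v =
        (b * N u) * (P * δ * N v) + s * δ * N u * (a * Cl * N v) + κ' * δ * (Cl' * N v) * N u + κ * (Cd * δ * N v) * N u := by rw [hP']; ring
    rw [e5]; linarith only [e1, e2, e3, e4]
  have hB : ‖⟪KU u, hessOp φ η U τ v⟫_ℂ - ⟪KV u, hessOp φ η V τ v⟫_ℂ‖ ≤ (P * b + P') * δ * N u * N v := by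
    refine TB.trans ?_
    have e1 : P * δ * N u * ‖covCurlL2K ℂ c₀ ((η : ℂ))⁻¹ (adTransportW φ U) v‖ ≤ P * δ * N u * (b * N v) :=
      mul_le_mul_of_nonneg_left hcUv (by positivity)
    have e2 : a * Cl * N u * (s * δ * ‖v‖) ≤ a * Cl * N u * (s * δ * N v) :=
      mul_le_mul_of_nonneg_left (mul_le_mul_of_nonneg_left hnv hsδ) (by positivity)
    have e3 : κ * ‖v‖ * (Cd * δ * N u) ≤ κ * N v * (Cd * δ * N u) :=
      mul_le_mul_of_nonneg_right (mul_le_mul_of_nonneg_left hnv hκ0) (by positivity)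
    have e4 : κ' * δ * ‖v‖ * (Cl' * N u) ≤ κ' * δ * N v * (Cl' * N u) :=
      mul_le_mul_of_nonneg_right (mul_le_mul_of_nonneg_left hnv hκ'δ) (by positivity)
    have e5 : (P * b + P') * δ * N u * N v =
        P * δ * N u * (b * N v) + a * Cl * N u * (s * δ * N v) + κ * N v * (Cd * δ * N u) + κ' * δ * N v * (Cl' * N u) := by rw [hP']; ring
    rw [e5]; linarith only [e1, e2, e3, e4]
  have hC : ‖⟪KU u, hessOp φ η U τ (KU v)⟫_ℂ - ⟪KU u, hessOp φ η V τ (KV v)⟫_ℂ‖ ≤ (a * Cl * P + Cl' * P') * δ * N u * N v := by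
    refine TC.trans ?_
    have e1 : ‖covCurlL2K ℂ c₀ ((η : ℂ))⁻¹ (adTransportW φ U) (KU u)‖ * (P * δ * N v) ≤ (a * Cl * N u) * (P * δ * N v) :=
      mul_le_mul_of_nonneg_right hcKUu (by positivity)
    have e2 : s * δ * ‖KU u‖ * (a * Cl * N v) ≤ s * δ * (Cl' * N u) * (a * Cl * N v) :=
      mul_le_mul_of_nonneg_right (mul_le_mul_of_nonneg_left hKUu hsδ) (by positivity)
    have e3 : κ' * δ * (Cl' * N v) * ‖KU u‖ ≤ κ' * δ * (Cl' * N v) * (Cl' * N u) := mul_le_mul_of_nonneg_left hKUu (by positivity)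
    have e4 : κ * (Cd * δ * N v) * ‖KU u‖ ≤ κ * (Cd * δ * N v) * (Cl' * N u) := mul_le_mul_of_nonneg_left hKUu (by positivity)
    have e5 : (a * Cl * P + Cl' * P') * δ * N u * N v = (a * Cl * N u) * (P * δ * N v) + s * δ * (Cl' * N u) * (a * Cl * N v) +
        κ' * δ * (Cl' * N v) * (Cl' * N u) + κ * (Cd * δ * N v) * (Cl' * N u) := by rw [hP']; ring
    rw [e5]; linarith only [e1, e2, e3, e4]
  have hM : ‖⟪KU u - KV u, hessOp φ η V τ (KV v)⟫_ℂ‖ ≤ ((s * Cl' + P) * a * Cl + κ * Cl' * Cd) * δ * N u * N v := by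
    refine TM.trans ?_
    have e1 : ‖covCurlL2K ℂ c₀ ((η : ℂ))⁻¹ (adTransportW φ V) (KU u - KV u)‖ * (a * Cl * N v) ≤ ((s * Cl' + P) * δ * N u) * (a * Cl * N v) :=
      mul_le_mul_of_nonneg_right hcVx (by positivity)
    have e2 : κ * (Cl' * N v) * ‖KU u - KV u‖ ≤ κ * (Cl' * N v) * (Cd * δ * N u) := mul_le_mul_of_nonneg_left hKUVu (by positivity)
    have e5 : ((s * Cl' + P) * a * Cl + κ * Cl' * Cd) * δ * N u * N v =
        ((s * Cl' + P) * δ * N u) * (a * Cl * N v) + κ * (Cl' * N v) * (Cd * δ * N u) := by ring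
    rw [e5]; linarith only [e1, e2]
  calc _ ≤ ‖-(⟪u, hessOp φ η U τ (KU v)⟫_ℂ - ⟪u, hessOp φ η V τ (KV v)⟫_ℂ) - (⟪KU u, hessOp φ η U τ v⟫_ℂ - ⟪KV u, hessOp φ η V τ v⟫_ℂ)‖ +
        ‖(⟪KU u, hessOp φ η U τ (KU v)⟫_ℂ - ⟪KU u, hessOp φ η V τ (KV v)⟫_ℂ) + ⟪KU u - KV u, hessOp φ η V τ (KV v)⟫_ℂ‖ := norm_add_le _ _
    _ ≤ (‖⟪u, hessOp φ η U τ (KU v)⟫_ℂ - ⟪u, hessOp φ η V τ (KV v)⟫_ℂ‖ + ‖⟪KU u, hessOp φ η U τ v⟫_ℂ - ⟪KV u, hessOp φ η V τ v⟫_ℂ‖) +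
        (‖⟪KU u, hessOp φ η U τ (KU v)⟫_ℂ - ⟪KU u, hessOp φ η V τ (KV v)⟫_ℂ‖ + ‖⟪KU u - KV u, hessOp φ η V τ (KV v)⟫_ℂ‖) := by
        refine add_le_add ((norm_sub_le _ _).trans (by rw [norm_neg])) (norm_add_le _ _)
    _ ≤ _ := by
        have e : (2 * (P * b + P') + (a * Cl * P + Cl' * P') + ((s * Cl' + P) * a * Cl + κ * Cl' * Cd)) * δ * N u * N v =
            ((P * b + P') * δ * N u * N v + (P * b + P') * δ * N u * N v) +
              ((a * Cl * P + Cl' * P') * δ * N u * N v + ((s * Cl' + P) * a * Cl + κ * Cl' * Cd) * δ * N u * N v) := by ring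
        rw [e]; exact add_le_add (add_le_add hA hB) (add_le_add hC hM)

end Literature.MathematicalPhysics.QuantumFieldTheory.Balaban1983to89.B9Eq3120DeltaPiPrimeFormTwoBackgrounds

end

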